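import Literature.NumberTheory.EllipticCurves.IwasawaAlgebraProofs
import Literature.NumberTheory.EllipticCurves.IwasawaAlgebraCharIdealProofs
import HarnessLib

/-!
# `char_Λ(M / p^a M) ⊆ (p^a)` for a finitely generated `Λ`-module without `p`-torsion and with a
# non-torsion element (helper for crux `PrintX9.HowardContainmentLightFrameOfPrint`,
# stmt-BirchSwinnertonDyer-25235, line `torsion-depth-light-ofprint`, stub `stub_depthPos_muPart`; part II of III)

Summits-side helper (`--supports stmt-BirchSwinnertonDyer-25235`), generic module theory over the
Iwasawa algebra `Λ = ℤ_p⟦T⟧`: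

* `mem_augIdealP_of_smul_le`: if `M` is finitely generated with a non-torsion element and `s • M ⊆ p • M`,
  then `s ∈ (p)` — Cayley–Hamilton for `s • id` relative to the ideal `(p)`
  (`LinearMap.exists_monic_and_natDegree_eq_and_coeff_mem_pow_and_aeval_eq_zero`) gives a monic `q`
  with lower coefficients in `(p)` and `q(s) • M = 0`; a non-torsion element forces `q(s) = 0`, so
  `s^n ∈ (p)`, a prime (`isPrime_augIdealP_holds`).
* `lengthAt_quotient_smul_ne_zero`: hence `(p) ∈ Supp(M/pM)` (`Module.support_eq_zeroLocus`), i.e. the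
  local length of `M/pM` at the height-one prime `(p)` is non-zero; with `charIdeal_le_of_lengthAt_ne_zero`
  (the exponent of `(p)` in the finite product `char(M/pM)` is positive) `char(M/pM) ⊆ (p)`.
* `charIdeal_quotient_pow_smul_le`: **`char(M/p^aM) ⊆ (p^a)`** by induction along the exact sequences
  `0 → M/pM → M/p^{a+1}M → M/p^aM → 0` (first map = multiplication by `p^a`, injective as `M` has no
  `p`-torsion) and multiplicativity of `char` (`Module.charIdeal_eq_mul_of_exact`).

HONEST FRAMING: module bookkeeping; no named fact; closes nothing by itself.

References: H. Matsumura, *Commutative Ring Theory*, Thm. 2.1 (Cayley–Hamilton / determinant trick);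
L. Washington, *Introduction to Cyclotomic Fields*, §13.2 (characteristic ideal, the prime `(p)`, `μ`);
NSW, *Cohomology of Number Fields*, Ch. V §3 Remark 2 after (5.3.9) (multiplicativity of `char`).
-/

set_option linter.dupNamespace false
set_option autoImplicit false

noncomputable section

open scoped Classical Pointwise

universe u

open Literature.NumberTheory.EllipticCurves

namespace Summit.BirchSwinnertonDyer.BirchSwinnertonDyer.Theorems.PrintX9Rescaling

/-! ## §5 `char(M / p^a M) ⊆ (p^a)` for `M` finitely generated, `p`-torsion-free, not torsion -/

section CharPow

variable {p : ℕ} [Fact p.Prime] {M : Type*} [AddCommGroup M] [Module (IwasawaAlgebra p) M]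

/-- `(p : Λ) ∈ (p)`. [folklore] -/
theorem natCast_mem_augIdealP : (p : IwasawaAlgebra p) ∈ IwasawaAlgebra.augIdealP p := by
  rw [IwasawaAlgebra.augIdealP, ← map_natCast (PowerSeries.C (R := ℤ_[p])) p]
  exact Ideal.mem_span_singleton_self _

/-- **The annihilator of `M/pM` lies in `(p)`** when `M` is finitely generated and has a non-torsion
element: if `s • M ⊆ p • M`, Cayley–Hamilton for `s • id` with respect to the ideal `(p)`
(`LinearMap.exists_monic_and_natDegree_eq_and_coeff_mem_pow_and_aeval_eq_zero`) gives a monic `q` with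
lower coefficients in `(p)` and `q(s) • M = 0`; on a non-torsion element this forces `q(s) = 0`, so
`s^n ∈ (p)` and `s ∈ (p)`. [cite: Matsumura1987, Thm. 2.1 (Cayley–Hamilton / determinant trick)] -/
theorem mem_augIdealP_of_smul_le [Module.Finite (IwasawaAlgebra p) M]
    (hM : ∃ h : M, ∀ c : IwasawaAlgebra p, c • h = 0 → c = 0) {s : IwasawaAlgebra p}
    (hs : ∀ m : M, ∃ m' : M, s • m = (p : IwasawaAlgebra p) • m') : s ∈ IwasawaAlgebra.augIdealP p := by
  obtain ⟨h, hh⟩ := hM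
  set I : Ideal (IwasawaAlgebra p) := IwasawaAlgebra.augIdealP p with hI
  have hrange : LinearMap.range (algebraMap (IwasawaAlgebra p) (Module.End (IwasawaAlgebra p) M) s) ≤
      I • ⊤ := by
    rintro _ ⟨m, rfl⟩
    obtain ⟨m', hm'⟩ := hs m
    rw [Module.algebraMap_end_apply, hm']
    exact Submodule.smul_mem_smul natCast_mem_augIdealP Submodule.mem_top
  obtain ⟨q, hmonic, -, hcoeff, haeval⟩ :=
    LinearMap.exists_monic_and_natDegree_eq_and_coeff_mem_pow_and_aeval_eq_zero (IwasawaAlgebra p)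
      (algebraMap (IwasawaAlgebra p) (Module.End (IwasawaAlgebra p) M) s) I hrange
  -- `q(s) = 0` in `Λ`
  have hqs : Polynomial.aeval s q = 0 := by
    apply hh
    have := LinearMap.congr_fun haeval h
    rwa [Polynomial.aeval_algebraMap_apply, Module.algebraMap_end_apply, LinearMap.zero_apply] at this
  -- `s ^ n = -(lower terms) ∈ (p)`
  have hn : s ^ q.natDegree ∈ I := by
    have hsum := hqs
    rw [Polynomial.aeval_eq_sum_range, Finset.sum_range_succ, hmonic.coeff_natDegree, one_smul,
      add_eq_zero_iff_neg_eq] at hsum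
    rw [← hsum]
    refine I.neg_mem (I.sum_mem fun i hi ↦ ?_)
    rw [smul_eq_mul]
    refine I.mul_mem_right _ ?_
    have hlt : i < q.natDegree := Finset.mem_range.mp hi
    exact Ideal.pow_le_self (Nat.sub_ne_zero_of_lt hlt) (hcoeff i)
  exact (IwasawaAlgebra.isPrime_augIdealP_holds p).mem_of_pow_mem _ hn

/-- **`(p)` is in the support of `M/pM`**, i.e. `ℓ_{(p)}(M/pM) ≠ 0`, for `M` finitely generated with a
non-torsion element (the annihilator of `M/pM` lies in `(p)`, `Module.support_eq_zeroLocus`).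
[cite: Washington1997, §13.2 (local length at (p) = μ-invariant)] -/
theorem lengthAt_quotient_smul_ne_zero [Module.Finite (IwasawaAlgebra p) M]
    (hM : ∃ h : M, ∀ c : IwasawaAlgebra p, c • h = 0 → c = 0) :
    Module.lengthAt (IwasawaAlgebra p) (M ⧸ ((p : IwasawaAlgebra p) • (⊤ : Submodule (IwasawaAlgebra p) M)))
      ⟨IwasawaAlgebra.augIdealP p, IwasawaAlgebra.isPrime_augIdealP_holds p⟩ ≠ 0 := by
  rw [Ne, Module.lengthAt_eq_zero_iff, ← not_nontrivial_iff_subsingleton, not_not,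
    ← Module.mem_support_iff, Module.support_eq_zeroLocus, PrimeSpectrum.mem_zeroLocus,
    SetLike.coe_subset_coe]
  intro s hs
  refine mem_augIdealP_of_smul_le hM fun m ↦ ?_
  have hsm : s • Submodule.Quotient.mk (p := (p : IwasawaAlgebra p) • (⊤ : Submodule (IwasawaAlgebra p) M)) m = 0 :=
    Module.mem_annihilator.mp hs _
  rw [← Submodule.Quotient.mk_smul, Submodule.Quotient.mk_eq_zero, Submodule.mem_smul_pointwise_iff_exists] at hsm
  obtain ⟨m', -, hm'⟩ := hsm
  exact ⟨m', hm'.symm⟩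

/-- For a height-one prime `𝔭` in the support of a finitely generated torsion module over a Noetherian
domain, `char(M) ⊆ 𝔭` (`𝔭^{ℓ_𝔭(M)}` divides the finite product). [folklore] -/
theorem charIdeal_le_of_lengthAt_ne_zero {R : Type*} [CommRing R] [IsNoetherianRing R] [IsDomain R]
    {M : Type*} [AddCommGroup M] [Module R M] [Module.Finite R M]
    (hM : Module.IsTorsion R M) {𝔭 : PrimeSpectrum R} (h𝔭 : 𝔭.asIdeal.height = 1)
    (h : Module.lengthAt R M 𝔭 ≠ 0) : Module.charIdeal R M ≤ 𝔭.asIdeal := by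
  obtain ⟨s, hsann, hs0⟩ := Submodule.annihilator_top_inter_nonZeroDivisors hM
  have hs : s ≠ 0 := nonZeroDivisors.ne_zero hs0
  have hsM : Module.IsTorsionBy R M s := fun x =>
    Submodule.mem_annihilator.mp hsann x Submodule.mem_top
  have hfin := Module.finite_heightOne_inter_mulSupport hs hsM
  have hn : (Module.lengthAt R M 𝔭).toNat ≠ 0 := by
    rw [Ne, ENat.toNat_eq_zero, not_or]
    exact ⟨h, Module.lengthAt_ne_top_of_isTorsionBy hs hsM 𝔭 (le_of_eq h𝔭)⟩
  have hdvd : 𝔭.asIdeal ^ (Module.lengthAt R M 𝔭).toNat ∣ Module.charIdeal R M := by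
    unfold Module.charIdeal
    rw [finprod_mem_def]
    have hmem : 𝔭 ∈ {𝔭 : PrimeSpectrum R | 𝔭.asIdeal.height = 1} := h𝔭
    have := finprod_mem_dvd 𝔭
      (f := {𝔭 : PrimeSpectrum R | 𝔭.asIdeal.height = 1}.mulIndicator
        fun 𝔭 => 𝔭.asIdeal ^ (Module.lengthAt R M 𝔭).toNat)
      (by rw [Function.HasFiniteMulSupport, Set.mulSupport_mulIndicator]; exact hfin)
    rwa [Set.mulIndicator_of_mem hmem] at this
  exact (Ideal.le_of_dvd hdvd).trans (Ideal.pow_le_self hn)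

/-- The quotient `M / c • M` is torsion for `c ≠ 0`. [folklore] -/
theorem isTorsion_quotient_smul_top {c : IwasawaAlgebra p} (hc : c ≠ 0) :
    Module.IsTorsion (IwasawaAlgebra p) (M ⧸ (c • (⊤ : Submodule (IwasawaAlgebra p) M))) := by
  intro x
  obtain ⟨m, rfl⟩ := Submodule.mkQ_surjective _ x
  refine ⟨⟨c, mem_nonZeroDivisors_of_ne_zero hc⟩, ?_⟩
  rw [Submonoid.mk_smul, Submodule.mkQ_apply, ← Submodule.Quotient.mk_smul, Submodule.Quotient.mk_eq_zero]
  exact Submodule.smul_mem_pointwise_smul m c ⊤ Submodule.mem_top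

/-- **`char(M/pM) ⊆ (p)`** for `M` finitely generated over `Λ` with a non-torsion element.
[cite: Washington1997, §13.2 (characteristic ideal, μ-invariant)] -/
theorem charIdeal_quotient_smul_le [Module.Finite (IwasawaAlgebra p) M]
    (hM : ∃ h : M, ∀ c : IwasawaAlgebra p, c • h = 0 → c = 0) :
    Module.charIdeal (IwasawaAlgebra p) (M ⧸ ((p : IwasawaAlgebra p) • (⊤ : Submodule (IwasawaAlgebra p) M))) ≤
      Ideal.span {(p : IwasawaAlgebra p)} := by
  have hp0 : (p : IwasawaAlgebra p) ≠ 0 := by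
    rw [← map_natCast (PowerSeries.C (R := ℤ_[p])) p]
    exact (IwasawaAlgebra.prime_C p).ne_zero
  have hheight : (⟨IwasawaAlgebra.augIdealP p, IwasawaAlgebra.isPrime_augIdealP_holds p⟩ :
      PrimeSpectrum (IwasawaAlgebra p)).asIdeal.height = 1 := IwasawaAlgebra.height_augIdealP_holds p
  have h := charIdeal_le_of_lengthAt_ne_zero (R := IwasawaAlgebra p) (isTorsion_quotient_smul_top hp0)
    hheight (lengthAt_quotient_smul_ne_zero hM)
  have heq : (⟨IwasawaAlgebra.augIdealP p, IwasawaAlgebra.isPrime_augIdealP_holds p⟩ :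
      PrimeSpectrum (IwasawaAlgebra p)).asIdeal = Ideal.span {(p : IwasawaAlgebra p)} := by
    show IwasawaAlgebra.augIdealP p = _
    rw [IwasawaAlgebra.augIdealP, map_natCast]
  exact h.trans heq.le

/-- **`char(M/p^aM) ⊆ (p^a)`** for `M` finitely generated over `Λ`, without `p`-torsion, with a
non-torsion element: induction on `a` along the exact sequences
`0 → M/pM → M/p^{a+1}M → M/p^aM → 0` (first map = multiplication by `p^a`, injective because `M` has no
`p`-torsion) and multiplicativity of `char` (`Module.charIdeal_eq_mul_of_exact`).
[cite: NeukirchSchmidtWingberg2008, Ch. V §3, Remark 2 after (5.3.9) (multiplicativity of char)] [cite: Washington1997, §13.2] -/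
theorem charIdeal_quotient_pow_smul_le [Module.Finite (IwasawaAlgebra p) M]
    (hfree : ∀ m : M, (p : IwasawaAlgebra p) • m = 0 → m = 0)
    (hM : ∃ h : M, ∀ c : IwasawaAlgebra p, c • h = 0 → c = 0) (a : ℕ) :
    Module.charIdeal (IwasawaAlgebra p)
        (M ⧸ (((p : IwasawaAlgebra p) ^ a) • (⊤ : Submodule (IwasawaAlgebra p) M))) ≤
      Ideal.span {(p : IwasawaAlgebra p) ^ a} := by
  set π : IwasawaAlgebra p := (p : IwasawaAlgebra p) with hπ
  have hp0 : π ≠ 0 := by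
    rw [hπ, ← map_natCast (PowerSeries.C (R := ℤ_[p])) p]
    exact (IwasawaAlgebra.prime_C p).ne_zero
  have hfreePow : ∀ (b : ℕ) (m : M), (π ^ b) • m = 0 → m = 0 := by
    intro b
    induction b with
    | zero => intro m hm; rwa [pow_zero, one_smul] at hm
    | succ b ih => intro m hm; rw [pow_succ, mul_smul] at hm; exact hfree m (ih _ hm)
  induction a with
  | zero =>
    rw [pow_zero, Ideal.span_singleton_one]
    exact le_top
  | succ a ih =>
    -- the submodules `N_b = π^b • M`
    set N : ℕ → Submodule (IwasawaAlgebra p) M := fun b ↦ (π ^ b) • (⊤ : Submodule (IwasawaAlgebra p) M)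
      with hN
    have hmemN : ∀ (b : ℕ) (m : M), m ∈ N b ↔ ∃ m' : M, m = (π ^ b) • m' := fun b m ↦ by
      rw [hN, Submodule.mem_smul_pointwise_iff_exists]
      exact ⟨fun ⟨m', _, h⟩ ↦ ⟨m', h.symm⟩, fun ⟨m', h⟩ ↦ ⟨m', Submodule.mem_top, h.symm⟩⟩
    -- `f : M/πM → M/π^{a+1}M`, `[m] ↦ [π^a m]`
    have hle : N 1 ≤ (N (a + 1)).comap (DistribSMul.toLinearMap (IwasawaAlgebra p) M (π ^ a)) := by
      intro m hm
      obtain ⟨m', rfl⟩ := (hmemN 1 m).1 hm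
      rw [Submodule.mem_comap, DistribSMul.toLinearMap_apply, hmemN]
      exact ⟨m', by rw [smul_smul, pow_one, ← pow_succ]⟩
    let f : (M ⧸ N 1) →ₗ[IwasawaAlgebra p] M ⧸ N (a + 1) := Submodule.mapQ _ _ _ hle
    have hf : Function.Injective f := by
      rw [← LinearMap.ker_eq_bot, eq_bot_iff]
      intro x hx
      obtain ⟨m, rfl⟩ := Submodule.mkQ_surjective _ x
      rw [LinearMap.mem_ker, Submodule.mkQ_apply, Submodule.mapQ_apply, Submodule.Quotient.mk_eq_zero,
        hmemN, DistribSMul.toLinearMap_apply] at hx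
      obtain ⟨m', hm'⟩ := hx
      rw [Submodule.mem_bot, Submodule.mkQ_apply, Submodule.Quotient.mk_eq_zero, hmemN]
      refine ⟨m', sub_eq_zero.mp (hfreePow a _ ?_)⟩
      rw [smul_sub, hm', smul_smul, pow_one, ← pow_succ, sub_self]
    -- `g : M/π^{a+1}M → M/π^aM` the factor map
    have hle' : N (a + 1) ≤ N a := by
      intro m hm
      obtain ⟨m', rfl⟩ := (hmemN (a + 1) m).1 hm
      exact (hmemN a _).2 ⟨π • m', by rw [smul_smul, pow_succ]⟩
    let g : (M ⧸ N (a + 1)) →ₗ[IwasawaAlgebra p] M ⧸ N a := Submodule.factor hle'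
    have hg : Function.Surjective g := Submodule.factor_surjective hle'
    have hfg : Function.Exact f g := by
      intro y
      obtain ⟨m, rfl⟩ := Submodule.mkQ_surjective _ y
      constructor
      · intro hy
        rw [Submodule.factor_mk, Submodule.mkQ_apply, Submodule.Quotient.mk_eq_zero, hmemN] at hy
        obtain ⟨m', hm'⟩ := hy
        refine ⟨Submodule.Quotient.mk m', ?_⟩
        rw [Submodule.mapQ_apply, DistribSMul.toLinearMap_apply, Submodule.mkQ_apply, hm']
      · rintro ⟨x, hx⟩
        obtain ⟨m', rfl⟩ := Submodule.mkQ_surjective _ x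
        rw [Submodule.mkQ_apply, Submodule.mapQ_apply, DistribSMul.toLinearMap_apply, Submodule.mkQ_apply,
          Submodule.Quotient.eq] at hx
        obtain ⟨m₂, hm₂⟩ := (hmemN (a + 1) _).1 hx
        rw [Submodule.factor_mk, Submodule.mkQ_apply, Submodule.Quotient.mk_eq_zero, hmemN]
        exact ⟨m' - π • m₂, by rw [smul_sub, smul_smul, ← pow_succ, ← hm₂, sub_sub_cancel]⟩
    haveI : Module.Finite (IwasawaAlgebra p) (M ⧸ N (a + 1)) := inferInstance
    have htor : Module.IsTorsion (IwasawaAlgebra p) (M ⧸ N (a + 1)) :=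
      isTorsion_quotient_smul_top (pow_ne_zero _ hp0)
    rw [Module.charIdeal_eq_mul_of_exact htor f g hf hg hfg, pow_succ', ← Ideal.span_singleton_mul_span_singleton]
    refine Ideal.mul_mono ?_ ih
    have hN1 : N 1 = π • (⊤ : Submodule (IwasawaAlgebra p) M) := by
      show π ^ 1 • (⊤ : Submodule (IwasawaAlgebra p) M) = π • ⊤
      rw [pow_one]
    rw [hN1]
    exact charIdeal_quotient_smul_le (p := p) (M := M) hM

end CharPow

end Summit.BirchSwinnertonDyer.BirchSwinnertonDyer.Theorems.PrintX9Rescaling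

end
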